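import Mathlib
import Summits.NavierStokesRegularity.NavierStokesRegularity.Theorems.TaoLadderRungTwoBreakOneShiftWindowSensGlueZ
import HarnessLib

/-!
# One-shift window certificate, kernel side — part LXXIb: THE RENORMALISATION-FACTOR CLAUSE `hγedge` FROM THE TWO-RUN
# SENSITIVITY CHAIN — the rsqrt slope of part XII over a shell-1 energy floor on the final hull, the hull magnitudes at
# shell `1`, and part LXXI's flight-time bound per mode (cell harvest/h2-tao-ladder, seat p2; rung1/RUNG1-P2G16-REPORT.md §83
# (K2); support for K1(1) = `NoSurvivingDSSOne`, stmt-NavierStokesRegularity-20205)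

MODEL lattice only (the finite WINDOW system of a Tao-type averaged cascade); nothing here is a statement about the
Navier–Stokes equations; no item is closed; nothing numerical is asserted.

* `OneShiftFrame.abs_le_mag_of_mem_Hs` — a coordinate of a point of the final hull is bounded by the hull magnitude;
* **`OneShiftFrame.hγedge_of_gridCE`** — the clause `hγedge` of `T4W76R.ClausesFor` & co. for the CONSTRUCTED certificate from
  finite comparisons (energy floor `eLo > 0` on the final hull, `Γ ≥ (1/(2√eLo))/eLo`, and `Γ·Σ_i 2 A1_i (…) ≤ γ_x, γ_b, γ_e`).
-/

noncomputable section

-- the sub-problem namespace repeats the summit name by design (D-0017)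
set_option linter.dupNamespace false

namespace Summit.NavierStokesRegularity.NavierStokesRegularity.Theorems

namespace DSSOneShift

open Set Finset Metric Filter Topology TopologicalSpace
open Literature.Analysis.ODE Literature.Analysis.FluidPDE Literature.Analysis.FluidPDE.TaoCascade
open Summit.NavierStokesRegularity.NavierStokesRegularity.Theorems.TaylorModelCert
open Summit.NavierStokesRegularity.NavierStokesRegularity.Theorems.TaylorModelReadout
open Summit.NavierStokesRegularity.NavierStokesRegularity.Theorems.CertificateGlueOn

variable {m : ℕ}

namespace OneShiftFrame

variable (F : OneShiftFrame m)

section Glue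

variable {ε₀ : ℝ} {α : Fin m → Fin m → Fin m → ℤ × ℤ × ℤ → ℝ} {R : ℤ → ℝ}
variable {g : GridCD} {kd : KrawD} {e : F.SIdx ≃ Fin g.n}

/-! ### The clause `hγedge` -/

/-- The magnitude of a coordinate of a point of the final hull. [folklore] -/
theorem abs_le_mag_of_mem_Hs (M : F.FrameMatch g.toGridD kd e R) (hstep : ∀ s ≤ g.S, g.stepOK s = true)
    {x : F.SIdx → ℝ} (hx : x ∈ boxSet (boxOf e (g.step g.S).Hs)) (c : F.SIdx) :
    |x c| ≤ (IntervalD.mag (IntervalD.aget (g.step g.S).Hs (e c))).toReal := by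
  classical
  have hn := M.hn
  have hchkS : (g.step g.S).check = true := by
    have := hstep g.S le_rfl
    simp only [GridD.stepOK, Bool.and_eq_true, decide_eq_true_eq] at this
    exact this.1
  have hc' : (g.step g.S).toRoughStepD.check = true ∧ (g.step g.S).checkPair = true := by
    simpa [PairStepD.check, Bool.and_eq_true] using hchkS
  have hrc' : (g.step g.S).toRoughStepD.centre.check = true ∧ (g.step g.S).toRoughStepD.checkKZ = true := by
    simpa [RoughStepD.check, Bool.and_eq_true] using hc'.1
  obtain ⟨heta, hKZ⟩ := (g.step g.S).toRoughStepD.of_checkKZ hrc'.2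
  have hcw := (g.step g.S).toRoughStepD.centre.of_checkWith (by rw [← CentreStepD.check_eq]; exact hrc'.1)
  have hwfS : ∀ c < (g.step g.S).n, wfsD (IntervalD.aget (g.step g.S).S c) = true := fun c hc => (hcw.2.2.1 c hc).2.1
  have hZ : ∀ c < (g.step g.S).n, 0 ≤ (RoughStepD.dget (g.step g.S).Zh c).toReal := fun c hc => (hKZ c hc).1
  have hx' : x ∈ boxSet (boxOf (g.es e hn g.S) (g.step g.S).Hs) := by rw [GridD.boxOf_es]; exact hx
  have h := (g.step g.S).toRoughStepD.mem_of_mem_Hs (g.es e hn g.S) hwfS hZ heta hx' c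
  rw [GridD.es_val] at h
  exact IntervalD.abs_le_mag h

/-- **THE RENORMALISATION-FACTOR CLAUSE `hγedge` FROM THE CENTRED GRID AND THE SENSITIVITY CHAIN**: with the
hypotheses of part LXX, a shell-1 energy floor `eLo > 0` on the final hull, a bound `Γ ≥ (1/(2√eLo))/eLo` of the rsqrt
slope and the finite comparisons `Γ · Σ_i 2 A1_i (|finFv_(i,1)| r_τ + (pY_S + ZY_S)_(i,1)) ≤ γ_x`,
`Γ · Σ_i 2 A1_i (pT_S + ZT_S)_(i,1) ≤ γ_b`, `≤ γ_e` (`A1_i = |Hs_S|` at `(i, 1)`): for every two `AdmLip` points and all edge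
bounds `B, E`, `|g(z_u(τ_u)) − g(z_v(τ_v))| ≤ γ_x · dist(u,v) + γ_b · B + γ_e · E` — the clause `hγedge` of
`T4W76R.ClausesFor` & co. for the CONSTRUCTED certificate. [cite: Tao2016AveragedNS, §5.3; KapelaZgliczynski2009, §4 Lemma 8 / Thm. 9; cell vocabulary, harvest/h2-tao-ladder rung1/RUNG1-P2G9-REPORT.md §37 (hγedge), rung1/STAGE3-BANACH.md §2, rung1/RUNG1-P2G16-REPORT.md §83] -/
theorem hγedge_of_gridCE (hε : 0 ≤ ε₀) (hα : IsCancellingCoeff α)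
    (hEb : ∀ i, |F.tubeC i (-1)| + F.tubeR (-1) ≤ F.Eb) (hEt : ∀ i, |F.tubeC i F.W| + F.tubeR F.W ≤ F.Et)
    (M : F.FrameMatch g.toGridD kd e R)
    (Tc : ℕ → F.TIdx → BTerm F.SIdx) (rows : F.SIdx → List F.TIdx)
    (hRDc : ∀ s ≤ g.S, IsRTEncl (g.es e M.hn s) (Tc s) (Tc s) rows (g.step s).RD)
    (hRD : ∀ u : F.Space, ∀ s ≤ g.S, ∀ r ∈ Ico 0 (g.h s).toReal,
      IsRTEncl (g.es e M.hn s) (Tc s) (F.wterms ε₀ α (F.preclampTail u) (g.t s + r)) rows (g.step s).RD)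
    (hstep : ∀ s ≤ g.S, g.stepOK s = true) (hinit : g.initOK = true) (hprod : ∀ s < g.S, g.prodOKE s = true)
    (hpwf : ∀ s ≤ g.S, g.pwfOK s = true) (hpsub : ∀ s ≤ g.S, g.psubOK s = true)
    (hplink : ∀ s < g.S, g.plinkOK s = true) (hwlink : ∀ s < g.S, g.wlinkOK s = true)
    (hP0 : (fun c : F.SIdx => F.yc c.1 ((c.2 : ℕ) : ℤ)) ∈ boxSet (boxOf e (g.P 0)))
    (sd : SensD) (hsens : ∀ s ≤ g.S, g.sensStepOK sd s = true) (hlink : ∀ s < g.S, g.sensLinkOK sd s = true)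
    (ha0 : ∀ c : F.SIdx, F.a c.1 ((c.2 : ℕ) : ℤ) ≤ (sd.pYf 0 (e c)).toReal)
    {eLo : ℝ} (heLo : 0 < eLo) (he : ∀ x ∈ boxSet (boxOf e (g.step g.S).Hs), eLo ≤ ∑ i, x (i, ⟨1, M.hW1⟩) ^ 2)
    {Γ : ℝ} (hΓ : (1 / (2 * Real.sqrt eLo)) / eLo ≤ Γ)
    (γx γb γe : ℝ)
    (hγx : Γ * ∑ i : Fin m, 2 * (IntervalD.mag (IntervalD.aget (g.step g.S).Hs (e (i, ⟨1, M.hW1⟩)))).toReal *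
      ((IntervalD.mag (IntervalD.aget g.finFv (e (i, ⟨1, M.hW1⟩)))).toReal * F.rτ +
        ((sd.pYf g.S (e (i, ⟨1, M.hW1⟩))).toReal + (sd.ZYf g.S (e (i, ⟨1, M.hW1⟩))).toReal)) ≤ γx)
    (hγb : Γ * ∑ i : Fin m, 2 * (IntervalD.mag (IntervalD.aget (g.step g.S).Hs (e (i, ⟨1, M.hW1⟩)))).toReal *
      ((sd.pTf g.S (e (i, ⟨1, M.hW1⟩))).toReal + (sd.ZTf g.S (e (i, ⟨1, M.hW1⟩))).toReal) ≤ γb)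
    (hγe : Γ * ∑ i : Fin m, 2 * (IntervalD.mag (IntervalD.aget (g.step g.S).Hs (e (i, ⟨1, M.hW1⟩)))).toReal *
      ((sd.pTf g.S (e (i, ⟨1, M.hW1⟩))).toReal + (sd.ZTf g.S (e (i, ⟨1, M.hW1⟩))).toReal) ≤ γe)
    (C : F.WState × ℝ → F.WState × ℝ) (hC : ∀ r, C r = 0 → r = 0) :
    ∀ u v, F.AdmLip R u → F.AdmLip R v → ∀ B E : ℝ,
      (∀ i, ∀ t ∈ Icc 0 F.τhi, |F.decodeTail u i (-1) t - F.decodeTail v i (-1) t| ≤ B) →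
      (∀ i, ∀ t ∈ Icc 0 F.τhi, |F.decodeTail u i F.W t - F.decodeTail v i F.W t| ≤ E) →
      |gfac (slice (F.fullFamily (F.windowCertOfMatrix hε (lt_trans zero_lt_one M.hW1) hα hEb hEt C hC) u) (F.decodeTau u)) -
        gfac (slice (F.fullFamily (F.windowCertOfMatrix hε (lt_trans zero_lt_one M.hW1) hα hEb hEt C hC) v) (F.decodeTau v))| ≤
      γx * dist u v + γb * B + γe * E := by
  classical
  intro u v hu hv B E hB hE
  have hW1 := M.hW1
  have hn := M.hn
  have hW : 0 < F.W := lt_trans zero_lt_one hW1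
  set j1 : Fin F.W := ⟨1, M.hW1⟩ with hj1
  -- abbreviations
  set A1 : Fin m → ℝ := fun i => (IntervalD.mag (IntervalD.aget (g.step g.S).Hs (e (i, j1)))).toReal with hA1
  set Fm : Fin m → ℝ := fun i => (IntervalD.mag (IntervalD.aget g.finFv (e (i, j1)))).toReal with hFm
  set PY : Fin m → ℝ := fun i => (sd.pYf g.S (e (i, j1))).toReal + (sd.ZYf g.S (e (i, j1))).toReal with hPY
  set PT : Fin m → ℝ := fun i => (sd.pTf g.S (e (i, j1))).toReal + (sd.ZTf g.S (e (i, j1))).toReal with hPT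
  -- signs
  have hτc := F.τc_gt
  have hrτ := F.rτ_pos
  have hTS' : F.τhi ≤ g.t g.S + (g.h g.S).toReal := M.hTS.le
  have htS' : g.t g.S ≤ F.τhi := M.htS.trans (by unfold τhi; linarith)
  have hΓ0 : 0 ≤ Γ := le_trans (by positivity) hΓ
  -- the two runs at their flight times lie in the final hull
  set Swu := F.windowRunMap ε₀ α (F.preclampY u) (F.preclampTail u) with hSwudef
  set Swv := F.windowRunMap ε₀ α (F.preclampY v) (F.preclampTail v) with hSwvdef
  have hrun : ∀ {w : F.Space}, F.AdmLip R w → ∀ τ ∈ Icc (g.t g.S) F.τhi,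
      F.flatRun (F.windowRunMap ε₀ α (F.preclampY w) (F.preclampTail w)) τ ∈ boxSet (boxOf e (g.step g.S).Hs) := by
    intro w hw τ hτ
    have hSw : F.IsRunFrom ε₀ α (F.preclampY w) (F.preclampTail w) (F.windowRunMap ε₀ α (F.preclampY w) (F.preclampTail w)) :=
      F.isRunFrom_windowRunMap hε hW hα hEb hEt hw.1
    have hfw : ∀ t ∈ Icc 0 F.τhi, HasDerivWithinAt (F.flatRun (F.windowRunMap ε₀ α (F.preclampY w) (F.preclampTail w)))
        (termField (F.wterms ε₀ α (F.preclampTail w) t) (F.flatRun (F.windowRunMap ε₀ α (F.preclampY w) (F.preclampTail w)) t))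
        (Icc 0 F.τhi) t := by
      intro t ht
      have h := F.hasDerivWithinAt_flatRun hSw ht
      rwa [F.wfieldFlat_eq_termField] at h
    set Scw := F.windowRunMap ε₀ α (F.preclampY (F.zeroWin w)) (F.preclampTail (F.zeroWin w)) with hScwdef
    have hScw : F.IsRunFrom ε₀ α (F.preclampY (F.zeroWin w)) (F.preclampTail (F.zeroWin w)) Scw :=
      F.isRunFrom_windowRunMap hε hW hα hEb hEt (F.adm_zeroWin hw.1)
    have hfcw : ∀ t ∈ Icc 0 F.τhi, HasDerivWithinAt (F.flatRun Scw)
        (termField (F.wterms ε₀ α (F.preclampTail w) t) (F.flatRun Scw t)) (Icc 0 F.τhi) t := by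
      intro t ht
      have h := F.hasDerivWithinAt_flatRun hScw ht
      rwa [F.preclampTail_zeroWin, F.wfieldFlat_eq_termField] at h
    have hScw0 : F.flatRun Scw 0 = fun c : F.SIdx => F.yc c.1 ((c.2 : ℕ) : ℤ) := funext fun c => F.flatRun_zeroWin_zero hScw c
    have haw : F.flatRun (F.windowRunMap ε₀ α (F.preclampY w) (F.preclampTail w)) 0 ∈ boxSet (boxOf e (g.step 0).W) :=
      M.hW0 _ fun c => F.abs_flatRun_zero_sub_yc_le hSw c
    exact g.traj_mem_Hs_of_gridCE e hn hRDc (hRD w) hstep hinit hprod hpwf hpsub hplink hwlink htS' hP0 hScw0 hfcw haw rfl hfw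
      g.S le_rfl τ hτ (hτ.2.trans hTS')
  have hτu0 := F.decodeTau_mem_Icc hu.1
  have hτv0 := F.decodeTau_mem_Icc hv.1
  have hτu : F.decodeTau u ∈ Icc (g.t g.S) F.τhi := ⟨M.htS.trans hτu0.1, hτu0.2⟩
  have hτv : F.decodeTau v ∈ Icc (g.t g.S) F.τhi := ⟨M.htS.trans hτv0.1, hτv0.2⟩
  have hxu := hrun hu _ hτu
  have hxv := hrun hv _ hτv
  -- the shell-1 states
  set zu : Fin m → ℝ := fun i => F.flatRun Swu (F.decodeTau u) (i, j1) with hzu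
  set zv : Fin m → ℝ := fun i => F.flatRun Swv (F.decodeTau v) (i, j1) with hzv
  have hgu : gfac (slice (F.fullFamily (F.windowCertOfMatrix hε (lt_trans zero_lt_one M.hW1) hα hEb hEt C hC) u) (F.decodeTau u)) =
      (Real.sqrt (∑ i, zu i ^ 2))⁻¹ := by
    simp only [gfac, CertificateGlueOn.slice, hzu, flatRun, hj1, Nat.cast_one]; rfl
  have hgv : gfac (slice (F.fullFamily (F.windowCertOfMatrix hε (lt_trans zero_lt_one M.hW1) hα hEb hEt C hC) v) (F.decodeTau v)) =
      (Real.sqrt (∑ i, zv i ^ 2))⁻¹ := by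
    simp only [gfac, CertificateGlueOn.slice, hzv, flatRun, hj1, Nat.cast_one]; rfl
  have heu : eLo ≤ ∑ i, zu i ^ 2 := he _ hxu
  have hev : eLo ≤ ∑ i, zv i ^ 2 := he _ hxv
  have hAu : ∀ i, |zu i| ≤ A1 i := fun i => F.abs_le_mag_of_mem_Hs M hstep hxu (i, j1)
  have hAv : ∀ i, |zv i| ≤ A1 i := fun i => F.abs_le_mag_of_mem_Hs M hstep hxv (i, j1)
  -- there is at least one mode (the energy floor is positive), so `B, E ≥ 0`
  have hm : 0 < m := by
    rcases Nat.eq_zero_or_pos m with hm | hm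
    · exfalso
      subst hm
      simp only [Finset.univ_eq_empty, Finset.sum_empty] at heu
      linarith
    · exact hm
  have ht0' : (0 : ℝ) ∈ Icc 0 F.τhi := ⟨le_rfl, F.τhi_pos.le⟩
  have hB0 : 0 ≤ B := (abs_nonneg _).trans (hB ⟨0, hm⟩ 0 ht0')
  have hE0 : 0 ≤ E := (abs_nonneg _).trans (hE ⟨0, hm⟩ 0 ht0')
  have hδBE : max B E ≤ B + E := max_le (by linarith) (by linarith)
  have hΔ : ∀ i, |zu i - zv i| ≤ (Fm i * F.rτ + PY i) * dist u v + PT i * max B E ∧ 0 ≤ PT i := fun i =>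
    F.abs_runAt_sub_le_of_gridCE hε hα hEb hEt M Tc rows hRDc hRD hstep hinit hprod hpwf hpsub hplink hwlink hP0 sd hsens
      hlink ha0 hu hv hB hE (i, j1)
  -- the rsqrt slope
  obtain ⟨θ, hθmem, hθpos, hθ⟩ := exists_rsqrt_slope (heLo.trans_le heu) (heLo.trans_le hev)
  have hθlo : eLo ≤ θ := by
    rcases le_total (∑ i, zv i ^ 2) (∑ i, zu i ^ 2) with hle | hle
    · rw [uIcc_of_le hle] at hθmem; exact hev.trans hθmem.1
    · rw [uIcc_of_ge hle] at hθmem; exact heu.trans hθmem.1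
  have hγ : |rsqrtDeriv θ| ≤ Γ := (abs_rsqrtDeriv_le heLo hθlo).trans hΓ
  -- the energy difference
  have hH : |∑ i, zu i ^ 2 - ∑ i, zv i ^ 2| ≤ ∑ i, 2 * A1 i * ((Fm i * F.rτ + PY i) * dist u v + PT i * max B E) := by
    rw [OneShiftFrame.sum_sq_sub_sum_sq]
    refine (Finset.abs_sum_le_sum_abs _ _).trans (Finset.sum_le_sum fun i _ => ?_)
    rw [abs_mul]
    have h1 : |zu i + zv i| ≤ 2 * A1 i := (abs_add_le _ _).trans (by linarith [hAu i, hAv i])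
    have hA0 : 0 ≤ A1 i := (abs_nonneg _).trans (hAu i)
    exact mul_le_mul h1 (hΔ i).1 (abs_nonneg _) (by linarith)
  rw [hgu, hgv, hθ, abs_mul]
  have hd := dist_nonneg (x := u) (y := v)
  calc |rsqrtDeriv θ| * |∑ i, zu i ^ 2 - ∑ i, zv i ^ 2|
      ≤ Γ * ∑ i, 2 * A1 i * ((Fm i * F.rτ + PY i) * dist u v + PT i * max B E) :=
        mul_le_mul hγ hH (abs_nonneg _) hΓ0
    _ = (Γ * ∑ i, 2 * A1 i * (Fm i * F.rτ + PY i)) * dist u v + (Γ * ∑ i, 2 * A1 i * PT i) * max B E := by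
        simp only [Finset.mul_sum, Finset.sum_mul, ← Finset.sum_add_distrib]
        exact Finset.sum_congr rfl fun i _ => by ring
    _ ≤ γx * dist u v + (Γ * ∑ i, 2 * A1 i * PT i) * (B + E) := by
        have hcoef : 0 ≤ Γ * ∑ i, 2 * A1 i * PT i := mul_nonneg hΓ0 (Finset.sum_nonneg fun i _ =>
          mul_nonneg (mul_nonneg (by norm_num) ((abs_nonneg _).trans (hAu i))) (hΔ i).2)
        gcongr
    _ = γx * dist u v + (Γ * ∑ i, 2 * A1 i * PT i) * B + (Γ * ∑ i, 2 * A1 i * PT i) * E := by ring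
    _ ≤ γx * dist u v + γb * B + γe * E := by gcongr

end Glue

end OneShiftFrame

end DSSOneShift

end Summit.NavierStokesRegularity.NavierStokesRegularity.Theorems
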